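import Summits.BirchSwinnertonDyer.BirchSwinnertonDyer.Theorems.ThetaPartnerAtTwoSignedKatoUpToAtTwoLocalTwoPlusPointsExact
import Summits.BirchSwinnertonDyer.BirchSwinnertonDyer.Theorems.ThetaPartnerAtTwoSignedControlAtTwoPlusLayerTwo
import Summits.BirchSwinnertonDyer.Rank1Residual.Additive.StrictSignedSelmerInftyLocal
import Summits.BirchSwinnertonDyer.Rank1Residual.Additive.CyclotomicTowerSignedLocalIntersection
import HarnessLib

/-!
# Route `ThetaPartnerAtTwo` (TP2), crux K3 `SignedKatoDivisibilityUpToAtTwo` (item stmt-BirchSwinnertonDyer-20308),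
# line `colemanrat` v3 — THE LOCAL THEORY AT `p = 2`, file 13: the REAL LAYERS `ℚ_{2,n} = ℚ₂(ζ_{2^{n+2}})⁺ ⊂ K_{n+1,v} = ℚ₂(ζ_{2^{n+2}})`
# — Galois bookkeeping (`Gal(ℚ̄₂/ℚ_{2,n}) = Stab ζ_{2^{n+2}} ∪ σ₀·Stab ζ_{2^{n+2}}`), layer points
# (`E(ℚ_{2,n}) ⊆ E(K_{n+1,v})`, `E(ℚ_{2,m}) = E(ℚ_{2,m+1}) ∩ E(K_{m+1,v})`, `Δ`-averages) and the TRACE TRANSFER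
# `Tr^ℚ_{n/j} = Tr^K_{n+1/j+1}` on `E(ℚ_{2,n})` between Def. 1.1's `ℤ₂`-tower traces and the μ-tower traces

HONEST FRAMING (cell `bsd-wall`, width seat `bsd-wall-tp2-p2x-w2` g2): THEOREMS ONLY — no definition, no named fact, no
instance, no `sorry`; Galois bookkeeping of the `2`-adic cyclotomic tower and of the local point groups; nothing about any
Selmer group is asserted; closes no item; BSD is NOT proved by any of this. Consumed by the sequel file 14
`…LocalTwoSignFlip` (the sign-flip dictionary `E^ε(ℚ_{2,n}) = E(ℚ_{2,n}) ∩ E^{−ε}(K_{n+1,v})` and the robust `±`-decomposition).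

## Why this file

At `p = 2` the `n`-th layer of the cyclotomic `ℤ₂`-extension of `ℚ₂` is the REAL subfield `ℚ_{2,n} = ℚ₂(ζ_{2^{n+2}})⁺` of the
`(n+1)`-st μ-layer `K_{n+1,v} = ℚ₂(ζ_{2^{n+2}})` (NOT of `K_{n,v} = ℚ₂(ζ_{2^{n+1}})`), cut out in `Γ = Gal(ℚ̄₂/ℚ₂)` by
`Gal(ℚ̄₂/ℚ_{2,n}) = {τ : τζ_{2^{n+2}} = ζ_{2^{n+2}}^{±1}}` (the K4 seats' `SignedEC.PlusLayer.mem_localLayerSubgroupOfEmb_two_iff`, for the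
CYCLOTOMIC `κ : ZpExtension ℚ 2`). This file is the dictionary between the two Galois currencies in which Kobayashi's signed
groups are typed in the tree — Def. 1.1's `localLayerPointsOfEmb κ ι W n` / `localTraceOfEmb κ ι W j n` (K3's own objects, the
`ℤ₂`-tower) and §2 p. 4's `localFixedPointsOfEmb ι W (U k)` / `localPairTraceOfEmb ι W (U j) (U k)` for a tower `U` with LOCAL
subgroups `(U k)_ι = Stab ζ_{2^{k+1}}` (the μ-tower of the lead's files 7/10): restriction identifies `Gal(K_{n+1,v}/K_{j+1,v})`
with `Gal(ℚ_{2,n}/ℚ_{2,j})` (`0 ≤ j ≤ n`; `Stab ζ_{2^{j+2}} ∩ Gal(ℚ̄₂/ℚ_{2,n}) = Stab ζ_{2^{n+2}}`, and every element of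
`Gal(ℚ̄₂/ℚ_{2,j})` is `a` or `aσ₀⁻¹` with `a ∈ Stab ζ_{2^{j+2}}`, `σ₀` complex conjugation), so the two traces agree on `E(ℚ_{2,n})`.

## What is proved (`ζ_k = PadicCyclotomicTower.zeta 2 k`, `S_k = stab 2 k = Stab ζ_k`; `κ` cyclotomic, `ι : ℚ̄ → ℚ̄₂`, `hU : (U k)_ι = S_{k+1}`)

* §1 `inv_smul_zeta_eq_inv`, `mul_mem_stab_of_smul_zeta_eq_inv` (inverters; the lead's file `…LocalTwoPlusPointsExact` supplies
  `smul_zeta_eq_inv_of_le`, `mul_self_mem_stab_of_smul_zeta_eq_inv`, `stab_two_one`), `mem_localLayerSubgroupOfEmb_two_iff_zeta` / `stab_le_localLayerSubgroupOfEmb_two` /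
  `mem_localLayerSubgroupOfEmb_of_smul_zeta_eq_inv` / `mem_stab_or_mem_stab_of_mem_localLayer` (`Gal(ℚ̄₂/ℚ_{2,k}) = S_{k+2} ∪ σ₀S_{k+2}`),
  `mem_stab_of_mem_stab_of_mem_localLayer` (`S_{j+2} ∩ Gal(ℚ̄₂/ℚ_{2,n}) = S_{n+2}`).
* §2 `localLayerPointsOfEmb_le_localFixedPointsOfEmb_succ_two` (`E(ℚ_{2,n}) ⊆ E(K_{n+1,v})`), `localFixedPointsOfEmb_zero_eq_top_two`
  (`E(K_{0,v}) = E(ℚ₂)`: the degenerate bottom step `k₀ = k₋₁` at `2`), **`localLayerPointsOfEmb_eq_inf_succ_two`**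
  (`E(ℚ_{2,m}) = E(ℚ_{2,m+1}) ∩ E(K_{m+1,v})`), `add_smul_mem_localLayerPointsOfEmb_two` (`A + σ₀A ∈ E(ℚ_{2,n})` for `A ∈ E(K_{n+1,v})`).
* §3 `localPairTraceOfEmb_eq_of_bijective` (any `K`, `E`: two pairs of subgroups with bijective coset spaces have the same trace on
  common fixed points), `bijective_stabQuotient_to_layerQuotient_two`, **`localTraceOfEmb_eq_localPairTraceOfEmb_two`**
  (`Tr^ℚ_{n/j} P = Tr^K_{n+1/j+1} P` for `P ∈ E(ℚ_{2,n})`, `j ≤ n`).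

References: [Kobayashi2003] S. Kobayashi, Invent. Math. 152 (2003), Def. 1.1 (p. 2), §2 p. 4; [Washington1997] §13.1
(`ℚ_n = ℚ(ζ_{2^{n+2}})⁺`); [Sprung2012] p. 1487 (`k_n = ℚ₂(ζ_{2^{n+2}})` at `p = 2`); [Tate1967] §3.1 (complex conjugation).
-/

set_option autoImplicit false
-- the Theorems namespace of this sub repeats the summit name by design (D-0017 nested layout)
set_option linter.dupNamespace false

noncomputable section

open scoped Classical

universe u

namespace Summit.BirchSwinnertonDyer.BirchSwinnertonDyer.Theorems

namespace SignedKatoOffTwo.LocalTwo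

open Literature.NumberTheory.EllipticCurves Literature.NumberTheory.GaloisRepresentations WeierstrassCurve Field
open Summit.BirchSwinnertonDyer.Rank1Residual.Additive
open Summit.BirchSwinnertonDyer.Rank1Residual.Additive.PadicCyclotomicTower
open ZpExtension

/-! ## §1 Galois bookkeeping in `Gal(ℚ̄₂/ℚ₂)`: inverters, stabilisers and the real-layer subgroups -/

section Galois

/-- The inverse of an inverter of `ζ_M` inverts `ζ_M`. [folklore] -/
theorem inv_smul_zeta_eq_inv {σ : absoluteGaloisGroup ℚ_[2]} {M : ℕ} (hσ : σ • zeta 2 M = (zeta 2 M)⁻¹) :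
    σ⁻¹ • zeta 2 M = (zeta 2 M)⁻¹ := by
  have h : σ⁻¹ • (σ • zeta 2 M) = zeta 2 M := inv_smul_smul σ _
  rw [hσ, smul_inv'', inv_eq_iff_eq_inv] at h
  exact h

/-- `τ` inverts `ζ` ⟹ `τσ₀` and `σ₀⁻¹τ` fix `ζ`, for an inverter `σ₀` of `ζ = ζ_M`. [folklore] -/
theorem mul_mem_stab_of_smul_zeta_eq_inv {σ τ : absoluteGaloisGroup ℚ_[2]} {M : ℕ} (hσ : σ • zeta 2 M = (zeta 2 M)⁻¹)
    (hτ : τ • zeta 2 M = (zeta 2 M)⁻¹) : τ * σ ∈ stab 2 M ∧ σ⁻¹ * τ ∈ stab 2 M := by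
  refine ⟨?_, ?_⟩
  · rw [mem_stab_iff, mul_smul, hσ, smul_inv'', hτ, inv_inv]
  · rw [mem_stab_iff, mul_smul, hτ, smul_inv'', inv_smul_zeta_eq_inv hσ, inv_inv]

variable {κ : ZpExtension ℚ 2} (ι : AlgebraicClosure ℚ →ₐ[ℚ] AlgebraicClosure ℚ_[2])

/-- **`Gal(ℚ̄₂/ℚ_{2,k}) = {τ : τζ_{2^{k+2}} = ζ_{2^{k+2}}^{±1}}`** in the currency `zeta 2 (k+2)` of `PadicCyclotomicTower` (the K4 seats'
`SignedEC.PlusLayer.mem_localLayerSubgroupOfEmb_two_iff` at `ζ' = ζ_{k+2}`), `κ` cyclotomic. [cite: Washington1997, §13.1] -/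
theorem mem_localLayerSubgroupOfEmb_two_iff_zeta (hκ : κ.IsCyclotomic) (k : ℕ) (τ : absoluteGaloisGroup ℚ_[2]) :
    τ ∈ Kobayashi2003.localLayerSubgroupOfEmb κ ι k ↔
      τ • zeta 2 (k + 2) = zeta 2 (k + 2) ∨ τ • zeta 2 (k + 2) = (zeta 2 (k + 2))⁻¹ :=
  SignedEC.PlusLayer.mem_localLayerSubgroupOfEmb_two_iff ι hκ (isPrimitiveRoot_zeta 2 (k + 2)) τ

/-- `S_{k+2} = Stab ζ_{2^{k+2}} ≤ Gal(ℚ̄₂/ℚ_{2,k})` (`ℚ₂(ζ_{2^{k+2}}) ⊇ ℚ_{2,k}`). [cite: Washington1997, §13.1] -/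
theorem stab_le_localLayerSubgroupOfEmb_two (hκ : κ.IsCyclotomic) (k : ℕ) :
    stab 2 (k + 2) ≤ Kobayashi2003.localLayerSubgroupOfEmb κ ι k :=
  fun τ hτ => (mem_localLayerSubgroupOfEmb_two_iff_zeta ι hκ k τ).mpr (Or.inl ((mem_stab_iff τ).mp hτ))

/-- An inverter of `ζ_M` lies in `Gal(ℚ̄₂/ℚ_{2,k})` whenever `k + 2 ≤ M` (complex conjugation fixes every real layer).
[cite: Washington1997, §13.1] -/
theorem mem_localLayerSubgroupOfEmb_of_smul_zeta_eq_inv (hκ : κ.IsCyclotomic) {σ : absoluteGaloisGroup ℚ_[2]} {M : ℕ}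
    (hσ : σ • zeta 2 M = (zeta 2 M)⁻¹) {k : ℕ} (hk : k + 2 ≤ M) :
    σ ∈ Kobayashi2003.localLayerSubgroupOfEmb κ ι k :=
  (mem_localLayerSubgroupOfEmb_two_iff_zeta ι hκ k σ).mpr (Or.inr (smul_zeta_eq_inv_of_le hk hσ))

/-- **`Gal(ℚ̄₂/ℚ_{2,k}) = S_{k+2} ∪ σ₀ S_{k+2} = S_{k+2} ∪ S_{k+2} σ₀⁻¹`** for any inverter `σ₀` of some `ζ_M`, `M ≥ k + 2`: an element
of the real-layer subgroup either fixes `ζ_{k+2}` or differs from `σ₀` by an element fixing it. [cite: Washington1997, §13.1] -/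
theorem mem_stab_or_mem_stab_of_mem_localLayer (hκ : κ.IsCyclotomic) {σ : absoluteGaloisGroup ℚ_[2]} {M : ℕ}
    (hσ : σ • zeta 2 M = (zeta 2 M)⁻¹) {k : ℕ} (hk : k + 2 ≤ M) {τ : absoluteGaloisGroup ℚ_[2]}
    (hτ : τ ∈ Kobayashi2003.localLayerSubgroupOfEmb κ ι k) :
    τ ∈ stab 2 (k + 2) ∨ (τ * σ ∈ stab 2 (k + 2) ∧ σ⁻¹ * τ ∈ stab 2 (k + 2)) := by
  rcases (mem_localLayerSubgroupOfEmb_two_iff_zeta ι hκ k τ).mp hτ with h | h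
  · exact Or.inl ((mem_stab_iff τ).mpr h)
  · exact Or.inr (mul_mem_stab_of_smul_zeta_eq_inv (smul_zeta_eq_inv_of_le hk hσ) h)

/-- **`S_{j+2} ∩ Gal(ℚ̄₂/ℚ_{2,n}) = S_{n+2}` for `j ≤ n`**: an element fixing `ζ_{j+2}` cannot invert `ζ_{n+2}` (the K4 seats'
`smul_eq_self_of_smul_pow_eq_self_of_mem`, `ζ_{j+2} = ζ_{n+2}^{2^{n−j}}`). [cite: Washington1997, §13.1] -/
theorem mem_stab_of_mem_stab_of_mem_localLayer (hκ : κ.IsCyclotomic) {j n : ℕ} (hjn : j ≤ n)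
    {τ : absoluteGaloisGroup ℚ_[2]} (hS : τ ∈ stab 2 (j + 2)) (hL : τ ∈ Kobayashi2003.localLayerSubgroupOfEmb κ ι n) :
    τ ∈ stab 2 (n + 2) := by
  rw [mem_stab_iff] at hS ⊢
  refine SignedEC.PlusLayer.smul_eq_self_of_smul_pow_eq_self_of_mem ι hκ (isPrimitiveRoot_zeta 2 (n + 2)) hjn ?_ hL
  have hpow : zeta 2 (n + 2) ^ 2 ^ (n - j) = zeta 2 (j + 2) := by
    have h := zeta_add_pow 2 (j + 2) (n - j)
    rwa [show j + 2 + (n - j) = n + 2 by omega] at h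
  rw [hpow, hS]

end Galois

/-! ## §2 Points: `E(ℚ_{2,n}) ⊆ E(K_{n+1,v})`, `E(ℚ_{2,m}) = E(ℚ_{2,m+1}) ∩ E(K_{m+1,v})`, `Δ`-averages -/

section Points

variable {κ : ZpExtension ℚ 2} (ι : AlgebraicClosure ℚ →ₐ[ℚ] AlgebraicClosure ℚ_[2]) (W : WeierstrassCurve ℚ)
  {U : ℕ → Subgroup (absoluteGaloisGroup ℚ)}

/-- **`E(ℚ_{2,n}) ⊆ E(K_{n+1,v})`** (`K_{n+1,v} = ℚ₂(ζ_{2^{n+2}}) ⊇ ℚ_{2,n}`): for a tower `U` with local subgroups `S_{k+1}`,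
`localLayerPointsOfEmb κ ι W n ≤ localFixedPointsOfEmb ι W (U (n+1))`. [cite: Kobayashi2003, Def. 1.1 and §2 p. 4] [cite: Washington1997, §13.1] -/
theorem localLayerPointsOfEmb_le_localFixedPointsOfEmb_succ_two (hκ : κ.IsCyclotomic)
    (hU : ∀ k, localSubgroupOfEmb (U k) ι = stab 2 (k + 1)) (n : ℕ) :
    Kobayashi2003.localLayerPointsOfEmb κ ι W n ≤ localFixedPointsOfEmb ι W (U (n + 1)) := by
  intro P hP
  rw [mem_localFixedPointsOfEmb_iff]
  intro τ hτ
  rw [hU] at hτ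
  exact (Kobayashi2003.mem_localLayerPointsOfEmb_iff κ ι W n P).mp hP τ
    (stab_le_localLayerSubgroupOfEmb_two ι hκ n hτ)

/-- `E(ℚ₂) = E(ℚ_{2,0}) ⊆ E(L_w)` for every `H` (the bottom layer is fixed by everything). [cite: Kobayashi2003, Def. 1.1] -/
theorem localLayerPointsOfEmb_zero_le_localFixedPointsOfEmb (H : Subgroup (absoluteGaloisGroup ℚ)) :
    Kobayashi2003.localLayerPointsOfEmb κ ι W 0 ≤ localFixedPointsOfEmb ι W H := by
  intro P hP
  rw [mem_localFixedPointsOfEmb_iff]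
  exact fun τ _ => (Kobayashi2003.mem_localLayerPointsOfEmb_zero_iff κ ι W P).mp hP τ

/-- For a tower with local subgroups `S_{k+1}`: `E(K_{0,v}) = E(ℚ₂(ζ_2)) = E(ℚ₂) = E(K_{−1,v})`, i.e.
`localFixedPointsOfEmb ι W (U 0) = localFixedPointsOfEmb ι W ⊤` — the degenerate bottom step `k₀ = k₋₁` of the μ-tower at `2`.
[cite: Kobayashi2003, §2 p. 4 (K_{−1} = ℚ)] -/
theorem localFixedPointsOfEmb_zero_eq_top_two (hU : ∀ k, localSubgroupOfEmb (U k) ι = stab 2 (k + 1)) :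
    localFixedPointsOfEmb ι W (U 0) = localFixedPointsOfEmb ι W ⊤ := by
  ext P
  rw [mem_localFixedPointsOfEmb_iff, mem_localFixedPointsOfEmb_top_iff, hU 0]
  simp only [zero_add, stab_two_one, Subgroup.mem_top, forall_const]

/-- **`E(ℚ_{2,m}) = E(ℚ_{2,m+1}) ∩ E(K_{m+1,v})`** (`K_{m+1,v} = ℚ₂(ζ_{2^{m+2}})`; `Gal(ℚ̄₂/ℚ_{2,m})` is generated by
`Gal(ℚ̄₂/ℚ_{2,m+1})` and `S_{m+2}`: an element inverting `ζ_{m+2}` is `σ₀·(σ₀⁻¹τ)` with `σ₀` complex conjugation, which lies in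
`Gal(ℚ̄₂/ℚ_{2,m+1})`, and `σ₀⁻¹τ ∈ S_{m+2}`). [cite: Washington1997, §13.1] [cite: Kobayashi2003, Def. 1.1 and §2 p. 4] -/
theorem localLayerPointsOfEmb_eq_inf_succ_two (hκ : κ.IsCyclotomic)
    (hU : ∀ k, localSubgroupOfEmb (U k) ι = stab 2 (k + 1)) (m : ℕ) :
    Kobayashi2003.localLayerPointsOfEmb κ ι W m =
      Kobayashi2003.localLayerPointsOfEmb κ ι W (m + 1) ⊓ localFixedPointsOfEmb ι W (U (m + 1)) := by
  refine le_antisymm (le_inf (Kobayashi2003.localLayerPointsOfEmb_mono κ ι W (Nat.le_succ m))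
    (localLayerPointsOfEmb_le_localFixedPointsOfEmb_succ_two ι W hκ hU m)) ?_
  intro P hP
  obtain ⟨hP1', hP2'⟩ := AddSubgroup.mem_inf.mp hP
  have hP1 : ∀ τ ∈ Kobayashi2003.localLayerSubgroupOfEmb κ ι (m + 1), τ • P = P :=
    (Kobayashi2003.mem_localLayerPointsOfEmb_iff κ ι W (m + 1) P).mp hP1'
  have hP2 : ∀ τ ∈ stab 2 (m + 1 + 1), τ • P = P := fun τ hτ =>
    (mem_localFixedPointsOfEmb_iff ι W (U (m + 1)) P).mp hP2' τ (by rw [hU]; exact hτ)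
  refine (Kobayashi2003.mem_localLayerPointsOfEmb_iff κ ι W m P).mpr fun τ hτ => ?_
  obtain ⟨σ₀, hσ₀⟩ := exists_smul_zeta_eq_inv (p := 2) (m := m + 3) (by omega)
  have hσ₀L : σ₀ ∈ Kobayashi2003.localLayerSubgroupOfEmb κ ι (m + 1) :=
    mem_localLayerSubgroupOfEmb_of_smul_zeta_eq_inv ι hκ hσ₀ le_rfl
  rcases mem_stab_or_mem_stab_of_mem_localLayer ι hκ hσ₀ (by omega) hτ with h | ⟨-, h⟩
  · exact hP2 τ h
  · calc τ • P = (σ₀ * (σ₀⁻¹ * τ)) • P := by rw [mul_inv_cancel_left]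
      _ = σ₀ • (σ₀⁻¹ * τ) • P := mul_smul _ _ _
      _ = P := by rw [hP2 _ h, hP1 σ₀ hσ₀L]

/-- **`Δ`-averages are real**: for `A ∈ E(K_{n+1,v})` and `σ₀` an inverter of `ζ_{2^{n+2}}` (complex conjugation of
`K_{n+1,v}/ℚ_{2,n}`), `A + σ₀A ∈ E(ℚ_{2,n})` (`U (n+1)` normal, so `σ₀A ∈ E(K_{n+1,v})`, and `σ₀² ∈ S_{n+2}`).
[cite: Kobayashi2003, §2 p. 4] [cite: Washington1997, §13.1] -/
theorem add_smul_mem_localLayerPointsOfEmb_two [hUN : ∀ k, (U k).Normal] (hκ : κ.IsCyclotomic)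
    (hU : ∀ k, localSubgroupOfEmb (U k) ι = stab 2 (k + 1)) (n : ℕ) {σ₀ : absoluteGaloisGroup ℚ_[2]}
    (hσ₀ : σ₀ • zeta 2 (n + 2) = (zeta 2 (n + 2))⁻¹) {A : localPoints W ℚ_[2]}
    (hA : A ∈ localFixedPointsOfEmb ι W (U (n + 1))) :
    A + σ₀ • A ∈ Kobayashi2003.localLayerPointsOfEmb κ ι W n := by
  have hσA : σ₀ • A ∈ localFixedPointsOfEmb ι W (U (n + 1)) := smul_mem_localFixedPointsOfEmb ι W (U (n + 1)) σ₀ hA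
  rw [mem_localFixedPointsOfEmb_iff, hU] at hA hσA
  rw [Kobayashi2003.mem_localLayerPointsOfEmb_iff]
  intro τ hτ
  rcases mem_stab_or_mem_stab_of_mem_localLayer ι hκ hσ₀ le_rfl hτ with h | ⟨-, h⟩
  · rw [smul_add, hA τ h, hσA τ h]
  · have h2 : σ₀ • σ₀ • A = A := by rw [← mul_smul, hA _ (mul_self_mem_stab_of_smul_zeta_eq_inv hσ₀)]
    calc τ • (A + σ₀ • A) = (σ₀ * (σ₀⁻¹ * τ)) • (A + σ₀ • A) := by rw [mul_inv_cancel_left]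
      _ = σ₀ • (σ₀⁻¹ * τ) • (A + σ₀ • A) := mul_smul _ _ _
      _ = σ₀ • (A + σ₀ • A) := by rw [smul_add (σ₀⁻¹ * τ), hA _ h, hσA _ h]
      _ = A + σ₀ • A := by rw [smul_add, h2, add_comm]

end Points

/-! ## §3 Traces: `Tr^ℚ_{n/j} = Tr^K_{n+1/j+1}` on `E(ℚ_{2,n})` -/

section TraceTransfer

variable {K : Type u} [Field K] {E : Type u} [Field E] [Algebra K E]
  (ι : AlgebraicClosure K →ₐ[K] AlgebraicClosure E) (W : WeierstrassCurve K)

/-- **Trace transfer between two pairs of subgroups** (any `K`, `E`, `ι`): if the local subgroup of `A₁` is contained in that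
of `B₁` and the induced map of coset spaces `(A₁)_E/(A₂)_E → (B₁)_E/(B₂)_E` is a bijection, then the two traces
`Tr_{A₂/A₁}` and `Tr_{B₂/B₁}` agree on every point fixed by `(B₂)_E` (both are the sum over the same system of
representatives; `localPairTraceOfEmb_eq_sum_of_bijective`). [cite: Kobayashi2003, §2 p. 4 (the trace maps)] -/
theorem localPairTraceOfEmb_eq_of_bijective {A₁ A₂ B₁ B₂ : Subgroup (absoluteGaloisGroup K)}
    [A₂.FiniteIndex] [B₂.FiniteIndex] (hle : localSubgroupOfEmb A₁ ι ≤ localSubgroupOfEmb B₁ ι)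
    (hbij : Function.Bijective fun q : localSubgroupOfEmb A₁ ι ⧸
        (localSubgroupOfEmb A₂ ι).subgroupOf (localSubgroupOfEmb A₁ ι) =>
      (QuotientGroup.mk (Subgroup.inclusion hle q.out) :
        localSubgroupOfEmb B₁ ι ⧸ (localSubgroupOfEmb B₂ ι).subgroupOf (localSubgroupOfEmb B₁ ι)))
    {P : localPoints W E} (hPB : P ∈ localFixedPointsOfEmb ι W B₂) :
    localPairTraceOfEmb ι W A₁ A₂ P = localPairTraceOfEmb ι W B₁ B₂ P := by
  haveI : Fintype (localSubgroupOfEmb A₁ ι ⧸ (localSubgroupOfEmb A₂ ι).subgroupOf (localSubgroupOfEmb A₁ ι)) :=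
    Fintype.ofFinite _
  rw [localPairTraceOfEmb_eq_sum_of_bijective ι W B₁ B₂ hPB
      (fun q : localSubgroupOfEmb A₁ ι ⧸ (localSubgroupOfEmb A₂ ι).subgroupOf (localSubgroupOfEmb A₁ ι) =>
        Subgroup.inclusion hle q.out) hbij,
    localPairTraceOfEmb_apply]
  exact Finset.sum_congr rfl fun q _ => rfl

end TraceTransfer

section Trace

variable {κ : ZpExtension ℚ 2} (ι : AlgebraicClosure ℚ →ₐ[ℚ] AlgebraicClosure ℚ_[2]) (W : WeierstrassCurve ℚ)
  {U : ℕ → Subgroup (absoluteGaloisGroup ℚ)} [hUf : ∀ k, (U k).FiniteIndex]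

omit hUf in
/-- **`Gal(K_{n+1,v}/K_{j+1,v}) ≅ Gal(ℚ_{2,n}/ℚ_{2,j})` by restriction** (`j ≤ n`): the map of coset spaces
`S_{j+2}/S_{n+2} → Gal(ℚ̄₂/ℚ_{2,j})/Gal(ℚ̄₂/ℚ_{2,n})` induced by the inclusion `S_{j+2} ≤ Gal(ℚ̄₂/ℚ_{2,j})` is a bijection —
injective since `S_{j+2} ∩ Gal(ℚ̄₂/ℚ_{2,n}) = S_{n+2}`, surjective since every `τ ∈ Gal(ℚ̄₂/ℚ_{2,j})` is `a` or `aσ₀⁻¹` with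
`a ∈ S_{j+2}`, `σ₀ ∈ Gal(ℚ̄₂/ℚ_{2,n})` complex conjugation. [cite: Washington1997, §13.1] -/
theorem bijective_stabQuotient_to_layerQuotient_two (hκ : κ.IsCyclotomic)
    (hU : ∀ k, localSubgroupOfEmb (U k) ι = stab 2 (k + 1)) {j n : ℕ} (hjn : j ≤ n)
    (hle : localSubgroupOfEmb (U (j + 1)) ι ≤ localSubgroupOfEmb (κ.layerSubgroup j) ι) :
    Function.Bijective fun q : localSubgroupOfEmb (U (j + 1)) ι ⧸
        (localSubgroupOfEmb (U (n + 1)) ι).subgroupOf (localSubgroupOfEmb (U (j + 1)) ι) =>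
      (QuotientGroup.mk (Subgroup.inclusion hle q.out) :
        localSubgroupOfEmb (κ.layerSubgroup j) ι ⧸
          (localSubgroupOfEmb (κ.layerSubgroup n) ι).subgroupOf (localSubgroupOfEmb (κ.layerSubgroup j) ι)) := by
  have hS : ∀ k (τ : absoluteGaloisGroup ℚ_[2]), τ ∈ localSubgroupOfEmb (U k) ι ↔ τ ∈ stab 2 (k + 1) :=
    fun k τ => by rw [hU k]
  obtain ⟨σ₀, hσ₀⟩ := exists_smul_zeta_eq_inv (p := 2) (m := n + 2) (by omega)
  have hσ₀L : σ₀ ∈ Kobayashi2003.localLayerSubgroupOfEmb κ ι n :=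
    mem_localLayerSubgroupOfEmb_of_smul_zeta_eq_inv ι hκ hσ₀ le_rfl
  constructor
  · intro q₁ q₂ h
    have h' := QuotientGroup.eq.mp h
    rw [Subgroup.mem_subgroupOf, ← map_inv, ← map_mul, Subgroup.coe_inclusion] at h'
    -- `(q₁.out)⁻¹ * q₂.out` lies in the layer-`n` subgroup and in `S_{j+2}`, hence in `S_{n+2}`
    have hmemS : ((q₁.out⁻¹ * q₂.out : localSubgroupOfEmb (U (j + 1)) ι) : absoluteGaloisGroup ℚ_[2]) ∈
        stab 2 (j + 2) := (hS (j + 1) _).mp (q₁.out⁻¹ * q₂.out).2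
    have hmem : ((q₁.out⁻¹ * q₂.out : localSubgroupOfEmb (U (j + 1)) ι) : absoluteGaloisGroup ℚ_[2]) ∈
        localSubgroupOfEmb (U (n + 1)) ι :=
      (hS (n + 1) _).mpr (mem_stab_of_mem_stab_of_mem_localLayer ι hκ hjn hmemS h')
    rw [← QuotientGroup.out_eq' q₁, ← QuotientGroup.out_eq' q₂, QuotientGroup.eq, Subgroup.mem_subgroupOf]
    exact hmem
  · intro r
    set τ : absoluteGaloisGroup ℚ_[2] := ((r.out : localSubgroupOfEmb (κ.layerSubgroup j) ι) : absoluteGaloisGroup ℚ_[2])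
      with hτdef
    have hτ : τ ∈ Kobayashi2003.localLayerSubgroupOfEmb κ ι j := r.out.2
    -- choose `a ∈ S_{j+2}` with `a⁻¹ τ ∈ Gal(ℚ̄₂/ℚ_{2,n})`
    have hex : ∃ a : absoluteGaloisGroup ℚ_[2], a ∈ stab 2 (j + 2) ∧
        a⁻¹ * τ ∈ Kobayashi2003.localLayerSubgroupOfEmb κ ι n := by
      rcases mem_stab_or_mem_stab_of_mem_localLayer ι hκ hσ₀ (by omega) hτ with h | ⟨h, -⟩
      · exact ⟨τ, h, by rw [inv_mul_cancel]; exact one_mem _⟩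
      · refine ⟨τ * σ₀, h, ?_⟩
        rw [mul_inv_rev, mul_assoc, inv_mul_cancel, mul_one]
        exact inv_mem hσ₀L
    obtain ⟨a, haS, haτ⟩ := hex
    have ha : a ∈ localSubgroupOfEmb (U (j + 1)) ι := (hS (j + 1) a).mpr haS
    refine ⟨QuotientGroup.mk ⟨a, ha⟩, ?_⟩
    obtain ⟨h, hh⟩ := QuotientGroup.mk_out_eq_mul
      ((localSubgroupOfEmb (U (n + 1)) ι).subgroupOf (localSubgroupOfEmb (U (j + 1)) ι)) ⟨a, ha⟩
    have hhL : ((h : localSubgroupOfEmb (U (j + 1)) ι) : absoluteGaloisGroup ℚ_[2]) ∈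
        Kobayashi2003.localLayerSubgroupOfEmb κ ι n := by
      have hhS : ((h : localSubgroupOfEmb (U (j + 1)) ι) : absoluteGaloisGroup ℚ_[2]) ∈ stab 2 (n + 2) :=
        (hS (n + 1) _).mp (Subgroup.mem_subgroupOf.mp h.2)
      exact stab_le_localLayerSubgroupOfEmb_two ι hκ n hhS
    change QuotientGroup.mk (Subgroup.inclusion hle (QuotientGroup.mk (⟨a, ha⟩ : localSubgroupOfEmb (U (j + 1)) ι) :
        _ ⧸ (localSubgroupOfEmb (U (n + 1)) ι).subgroupOf (localSubgroupOfEmb (U (j + 1)) ι)).out) = r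
    rw [hh, ← QuotientGroup.out_eq' r, QuotientGroup.eq, Subgroup.mem_subgroupOf]
    simp only [Subgroup.coe_mul, Subgroup.coe_inv, Subgroup.coe_inclusion, mul_inv_rev, mul_assoc]
    exact mul_mem (inv_mem hhL) haτ

/-- **`Tr^ℚ_{n/j} P = Tr^K_{n+1/j+1} P` for `P ∈ E(ℚ_{2,n})`** (`0 ≤ j ≤ n`): Def. 1.1's trace `localTraceOfEmb κ ι W j n` along the
`ℤ₂`-tower coincides on `E(ℚ_{2,n}) ⊆ E(K_{n+1,v})` with the μ-tower trace `localPairTraceOfEmb ι W (U (j+1)) (U (n+1))` from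
`K_{n+1,v} = ℚ₂(ζ_{2^{n+2}})` down to `K_{j+1,v} = ℚ₂(ζ_{2^{j+2}})`. [cite: Kobayashi2003, Def. 1.1 and §2 p. 4] [cite: Washington1997, §13.1] -/
theorem localTraceOfEmb_eq_localPairTraceOfEmb_two (hκ : κ.IsCyclotomic)
    (hU : ∀ k, localSubgroupOfEmb (U k) ι = stab 2 (k + 1)) {j n : ℕ} (hjn : j ≤ n) {P : localPoints W ℚ_[2]}
    (hP : P ∈ Kobayashi2003.localLayerPointsOfEmb κ ι W n) :
    Kobayashi2003.localTraceOfEmb κ ι W j n P = localPairTraceOfEmb ι W (U (j + 1)) (U (n + 1)) P := by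
  have hle : localSubgroupOfEmb (U (j + 1)) ι ≤ localSubgroupOfEmb (κ.layerSubgroup j) ι := by
    rw [hU]; exact stab_le_localLayerSubgroupOfEmb_two ι hκ j
  rw [localTraceOfEmb_eq_localPairTraceOfEmb ι W κ j n]
  exact (localPairTraceOfEmb_eq_of_bijective ι W hle (bijective_stabQuotient_to_layerQuotient_two ι hκ hU hjn hle) hP).symm

end Trace

end SignedKatoOffTwo.LocalTwo

end Summit.BirchSwinnertonDyer.BirchSwinnertonDyer.Theorems

end
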